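import Summits.QuantumFields.YangMills.Theorems.BalabanUVNodesN18AdmTransportPlaqEnvelope
import Summits.QuantumFields.YangMills.Theorems.BalabanUVNodesN18AtGeneratedTables

/-!
# BalabanUVNodes ∕ node N18 = NE5 — N18 AT THE PLAQUETTE-ENVELOPE TABLES AND AT THE GENERATED TABLES INSIDE THEM: [I] p. 263 L9–13 («|∂(M^a U) − 1| < 2α₀′(L^aξ)²»,
# every `a`) as a theorem at the transport of record, node00-def-W1's clause `horig` discharged for the plaquette condition, N18's statement of record at the
# canonical ε-small fields in closed form, and its transfer to the generated reading — no side condition at `α_L`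
# (Track A, DAG node N18 = `T4OutputRate.NE5` :211; cluster K4 «SpineRates»; module 16b of seat pub-ymgap-dag-n18-d, strategy s2)

HONEST FRAMING.  Count-neutral kernel bookkeeping (`--supports … --as helper`), composition BY NAME of landed theorems; NE5 is NOT PRINTED and NOT proved;
N18 is NOT discharged; no inhabitant of `IsDatumOfRecord₁₂C` is claimed (K0′).  Only the PLAQUETTE half (1.11) of the print's small-field conditions is
modelled by these tables — the small-local-gauge half (1.12) (`CondI.localGauge`) is not touched, so the space table of record `spaceI` is NOT reached here.

WHY.  Module 13 (`…N18AdmTransportPlaqSmall`, p485563) typed the plaquette-small tables `(k, j, Y) ↦ (ι·, 0) '' {V | PlaqSmall (a F θ k) V}` with the transport clause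
`hT₀` a theorem GIVEN a threshold family `a` with sign, sharp [B-Avg] (51) step law and chart guard; dag-n18-e's module 11 (`…N18AdmTransportPlaqEnvelope`, p491982,
LENS card T8) discharged those for the ENVELOPE `e_{L,α}(ε_k²) = α·ε_k²·(1 + (4C_Lα∕(L²(L²−1)))·ε_k²)`, `C_L = 143·(16L²)²` (`admTransport_plaqEnvelope`, side
conditions `4C_Lα ≤ L²(L²−1)`, `32L²α ≤ δ_N∕2`), with NONE left at the canonical `α_L(N, F) = min (L²(L²−1)∕(4C_L)) (δ_N∕2∕(32L²))` (`admTransport_plaqEnvelope_alphaL`).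
Module 16a (`…N18AtGeneratedTables`) proved: a transport-closed table family containing the strictly small fields contains their averaging-closure and passes N18
to W1's generated reading.  THIS FILE instantiates: strictly `αε_k²`-small fields lie in the envelope tables (`le_plaqEnvelope`), so (§1) the generated tables of
`PlaqSmall (α·ε_k²)` under the transport of record lie inside the envelope tables and inside the `2αε_k²`-tables — W1's clause `horig` for the plaquette condition and
[I] p. 263 L9–13 as theorems — and N18 at the envelope tables gives N18 at the generated reading; (§2) at `α_L` every side condition disappears and N18's statement
of record at the canonical ε-small fields is displayed in closed form with table family, thresholds and transport clause pinned by name.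

WHAT (all `theorem`, 0 `def`).  §1 parametric `α`: `plaqSmall_mem_plaqEnvelopeTable`, `avGen_plaqSmall_mem_plaqEnvelopeTable`, ★ `spGen_plaqSmall_subset_plaqEnvelope`,
`spGen_plaqSmall_subset_two_mul`, ★ `horig_plaqSmall_plaqEnvelope`, ★ `plaqSmall_two_mul_avIter` ([I] p. 263 L9–13: `|∂(M^a U) − 1| < 2αε_k²` for `|∂U − 1| < αε_{k+a}²`,
EVERY `a`), `admBg_spGen_plaqSmall_nonempty`, ★ `s_N18_readingGenPlaqSmall₁₂_of_plaqEnvelope`.  §2 canonical `α_L`, no side condition: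
★ `s_N18_readingAdmPlaqEnvelope₁₂_iff` (N18's statement of record AT THE CANONICAL ε-SMALL FIELDS), `s_N18_readingAdmPlaqEnvelope₁₂_of_ofRecord`,
`spGen_plaqSmall_subset_plaqEnvelope_alphaL`, ★ `s_N18_readingGenPlaqSmall₁₂_of_plaqEnvelope_alphaL`.

One finite four-torus programme at fixed `ε`; NOT the continuum limit, NOT OS, NOT a mass gap, NOT Clay.  0 `def`, 0 `sorry`.  Sources (TYPES only): T. Bałaban,
CMP **109** (1987) [Balaban1987RG1] (0.4) p. 253, (0.18) p. 255, (0.21)–(0.25) pp. 256–257, Thm 1 p. 259, (1.11)–(1.16) p. 262, p. 263 L5–21 and (1.18);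
CMP **116** (1988) [Balaban1988RG2Cluster] (2.13) p. 14; CMP **98** (1985) [Balaban1985Averaging] Prop. 1 (51) and Prop. 2 (53)–(54) p. 26; C. King, CMP **103**
(1986) [King1986] (3.40)–(3.42) p. 660.
-/

noncomputable section

open Set Metric
open scoped Matrix.Norms.L2Operator

namespace YMDAG.N18.W1Reading

open Literature.MathematicalPhysics.QuantumFieldTheory.Balaban1983to89
open Literature.MathematicalPhysics.QuantumFieldTheory.Balaban1983to89.T4Continuum
open Literature.MathematicalPhysics.QuantumFieldTheory.Balaban1983to89.T4OutputRate (Window)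
open Literature.MathematicalPhysics.QuantumFieldTheory.Balaban1983to89.ExpMeanLog (deltaSU deltaSU_pos)
open Literature.MathematicalPhysics.QuantumFieldTheory.Balaban1983to89.Node00 (Stage12Params IsDatumOfRecord₁₂C NE2Objects₁₁ NE3Letters₁₁ prependCoupling
  MatA ιSU avOfRecord)
open Literature.MathematicalPhysics.QuantumFieldTheory.Balaban1983to89.Node00.Sect2 (domSys CPair ofBackgroundC cubeDom)
open Literature.MathematicalPhysics.QuantumFieldTheory.Balaban1983to89.Node00.W1 (ReadingData LevelPairing LetterInputs ClusterTower pairOfRecord functionalC AdmBg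
  AvGen avIter spGen mem_spGen_iff hT₀_spGen spGen_subset_of_hunif avGen_of_origin avGen_iff_origin)
open Summit.QuantumFields.BalabanUV.T4Continuum.B13Carriers (transportRaw)
open Summit.QuantumFields.BalabanUV.T4Continuum.Spine.NE5
open YMDAG.N18.HLayer
open YMDAG.UVSplit

variable {N : ℕ} [NeZero N]

/-! ## §1 The instance: strictly plaquette-small fields, the transport of record, the envelope tables (parametric `α`) -/

section Envelope

variable (α : T4Family → ℝ) (hα : ∀ F, 0 < α F)
  (hsmall : ∀ F : T4Family, 4 * (143 * ((16 : ℝ) * (F.L : ℝ) ^ 2) ^ 2) * α F ≤ (F.L : ℝ) ^ 2 * ((F.L : ℝ) ^ 2 - 1))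
  (hguard : ∀ F : T4Family, (32 : ℝ) * (F.L : ℝ) ^ 2 * α F ≤ deltaSU (Fin N) / 2)

include hα in
/-- **THE STRICTLY SMALL FIELDS ARE READ INSIDE THE ENVELOPE TABLES**: `|∂U − 1| < α·ε_k²` ⇒ `(ιU, 0)` lies in every entry of the level-`k` envelope table
(`le_plaqEnvelope`: `αε_k² ≤ e_{L,α}(ε_k²)`). [cite: Balaban1987RG1, (0.18) p.255 and p.263 L5-9, L19-21] -/
theorem plaqSmall_mem_plaqEnvelopeTable (F : T4Family) (θ : Stage12Params F N) (k : ℕ) (U : GaugeField (F.P k) 0 (Node00.SU N))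
    (hU : PlaqSmall (α F * F.eps k ^ 2) U) (j : ℕ) (Y : (domSys (F.P k) θ.τ9.M j).Dom) :
    ofBackgroundC (ιSU N) U ∈ (fun (k j : ℕ) (_ : (domSys (F.P k) θ.τ9.M j).Dom) =>
      ofBackgroundC (ιSU N) '' {V : GaugeField (F.P k) 0 (Node00.SU N) |
        PlaqSmall (α F * F.eps k ^ 2 * (1 + 4 * (143 * ((16 : ℝ) * (F.L : ℝ) ^ 2) ^ 2) * α F
          / ((F.L : ℝ) ^ 2 * ((F.L : ℝ) ^ 2 - 1)) * F.eps k ^ 2)) V}) k j Y :=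
  (mem_image_ofBackgroundC_iff _ U).2 fun p => (hU p).trans_le (le_plaqEnvelope F (hα F).le k)

include hα hsmall hguard in
/-- **GENERATED FIELDS ARE READ INSIDE THE ENVELOPE TABLES**: the averaging-closure (under the transport of record) of the strictly `αε²`-small fields lies in the
envelope tables — module 16a §1 with `hstrict := plaqSmall_mem_plaqEnvelopeTable` and `hT :=` dag-n18-e's `admTransport_plaqEnvelope`.
[cite: Balaban1987RG1, p.262 (iv) and p.263 L9-13; Balaban1985Averaging, Prop. 1 (51) p.26; King1986, (3.41)-(3.42) p.660] -/
theorem avGen_plaqSmall_mem_plaqEnvelopeTable (F : T4Family) (θ : Stage12Params F N) {k : ℕ} {U : GaugeField (F.P k) 0 (Node00.SU N)}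
    (h : AvGen (fun k (U : GaugeField (F.P k) 0 (Node00.SU N)) => PlaqSmall (α F * F.eps k ^ 2) U)
      (fun k => transportRaw F k (avOfRecord F N (k + 1) 0)) k U)
    (j : ℕ) (Y : (domSys (F.P k) θ.τ9.M j).Dom) :
    ofBackgroundC (ιSU N) U ∈ (fun (k j : ℕ) (_ : (domSys (F.P k) θ.τ9.M j).Dom) =>
      ofBackgroundC (ιSU N) '' {V : GaugeField (F.P k) 0 (Node00.SU N) |
        PlaqSmall (α F * F.eps k ^ 2 * (1 + 4 * (143 * ((16 : ℝ) * (F.L : ℝ) ^ 2) ^ 2) * α F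
          / ((F.L : ℝ) ^ 2 * ((F.L : ℝ) ^ 2 - 1)) * F.eps k ^ 2)) V}) k j Y :=
  avGen_mem_of_admTransport _ _ (fun k U hU j Y => plaqSmall_mem_plaqEnvelopeTable α hα F θ k U hU j Y)
    (fun k U hU j X => admTransport_plaqEnvelope α hα hsmall hguard F θ k U hU j X) h j Y

include hα hsmall hguard in
/-- ★ **THE GENERATED TABLES OF THE STRICTLY PLAQUETTE-SMALL FIELDS LIE INSIDE THE ENVELOPE TABLES** (node00-def-W1's `spGen … ⊆ sp`, its clause DISCHARGED for the
plaquette condition at the transport of record), entrywise, at every level. [cite: Balaban1987RG1, p.262 (iv), (1.11) p.262, (1.15)-(1.16) and p.263 L5-13] -/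
theorem spGen_plaqSmall_subset_plaqEnvelope (F : T4Family) (θ : Stage12Params F N) (k j : ℕ) (Y : (domSys (F.P k) θ.τ9.M j).Dom) :
    spGen F θ.τ9.M N (fun k (U : GaugeField (F.P k) 0 (Node00.SU N)) => PlaqSmall (α F * F.eps k ^ 2) U)
        (fun k => transportRaw F k (avOfRecord F N (k + 1) 0)) k j Y ⊆
      (fun (k j : ℕ) (_ : (domSys (F.P k) θ.τ9.M j).Dom) =>
        ofBackgroundC (ιSU N) '' {V : GaugeField (F.P k) 0 (Node00.SU N) |
          PlaqSmall (α F * F.eps k ^ 2 * (1 + 4 * (143 * ((16 : ℝ) * (F.L : ℝ) ^ 2) ^ 2) * α F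
            / ((F.L : ℝ) ^ 2 * ((F.L : ℝ) ^ 2 - 1)) * F.eps k ^ 2)) V}) k j Y :=
  spGen_subset_of_admTransport _ _ (fun k U hU j Y => plaqSmall_mem_plaqEnvelopeTable α hα F θ k U hU j Y)
    (fun k U hU j X => admTransport_plaqEnvelope α hα hsmall hguard F θ k U hU j X) k j Y

include hα hsmall hguard in
/-- **… AND INSIDE THE `2αε_k²`-TABLES** (the print's factor `2` of [I] p.263 L9-13, by `plaqEnvelope_le`): the generated family of the strictly `αε²`-small fields is read
inside `(ι·, 0) '' {V | |∂V − 1| < 2αε_k²}` at every level — the (1.11) half of [I]'s inclusion «natural spaces ⊂ U^c_j(·, α₀, α₁)» once `2α ≤ α₀`.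
[cite: Balaban1987RG1, (1.11) p.262 and p.263 L9-16; King1986, (3.41)-(3.42) p.660] -/
theorem spGen_plaqSmall_subset_two_mul (F : T4Family) (θ : Stage12Params F N) (k j : ℕ) (Y : (domSys (F.P k) θ.τ9.M j).Dom) :
    spGen F θ.τ9.M N (fun k (U : GaugeField (F.P k) 0 (Node00.SU N)) => PlaqSmall (α F * F.eps k ^ 2) U)
        (fun k => transportRaw F k (avOfRecord F N (k + 1) 0)) k j Y ⊆
      ofBackgroundC (ιSU N) '' {V : GaugeField (F.P k) 0 (Node00.SU N) | PlaqSmall (2 * (α F * F.eps k ^ 2)) V} := by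
  intro φ hφ
  obtain ⟨V, hV, rfl⟩ := spGen_plaqSmall_subset_plaqEnvelope α hα hsmall hguard F θ k j Y hφ
  exact mem_image_of_mem _ fun p => (hV p).trans_le (plaqEnvelope_le F (hα F).le k (hsmall F))

include hα hsmall hguard in
/-- ★ **node00-def-W1's CLAUSE `horig` FOR THE PLAQUETTE CONDITION, DISCHARGED AT THE TRANSPORT OF RECORD** (origin form): the `a`-fold average of record
`W1.avIter (transportRaw F · (avOfRecord F N (·+1) 0)) k a U₀` of ANY field `U₀` of the `(k+a)`-th torus with `|∂U₀ − 1| < αε_{k+a}²` is read inside the level-`k`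
envelope table — EVERY `a` ([I] p.263 L9-13 «M^n(U) = U^n on Λ_n», there unproved; King's one estimate uniform in `n`).
[cite: Balaban1987RG1, p.263 L9-13; Balaban1985Averaging, Prop. 1 (51) and Prop. 2 (53)-(54) p.26; King1986, (3.41)-(3.42) p.660] -/
theorem horig_plaqSmall_plaqEnvelope (F : T4Family) (θ : Stage12Params F N) (k a : ℕ) (U₀ : GaugeField (F.P (k + a)) 0 (Node00.SU N))
    (h₀ : PlaqSmall (α F * F.eps (k + a) ^ 2) U₀) (j : ℕ) (Y : (domSys (F.P k) θ.τ9.M j).Dom) :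
    ofBackgroundC (ιSU N) (avIter (Bk := fun k => GaugeField (F.P k) 0 (Node00.SU N)) (fun k => transportRaw F k (avOfRecord F N (k + 1) 0)) k a U₀) ∈
      (fun (k j : ℕ) (_ : (domSys (F.P k) θ.τ9.M j).Dom) =>
        ofBackgroundC (ιSU N) '' {V : GaugeField (F.P k) 0 (Node00.SU N) |
          PlaqSmall (α F * F.eps k ^ 2 * (1 + 4 * (143 * ((16 : ℝ) * (F.L : ℝ) ^ 2) ^ 2) * α F
            / ((F.L : ℝ) ^ 2 * ((F.L : ℝ) ^ 2 - 1)) * F.eps k ^ 2)) V}) k j Y :=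
  horig_of_admTransport (fun k (U : GaugeField (F.P k) 0 (Node00.SU N)) => PlaqSmall (α F * F.eps k ^ 2) U) _
    (fun k U hU j Y => plaqSmall_mem_plaqEnvelopeTable α hα F θ k U hU j Y)
    (fun k U hU j X => admTransport_plaqEnvelope α hα hsmall hguard F θ k U hU j X) k a U₀ h₀ j Y

include hα hsmall hguard in
/-- ★ **[I] p.263 L9-13 AS A THEOREM**: `|∂(M^a U₀) − 1| < 2αε_k²` for every field `U₀` of the `(k+a)`-th torus with `|∂U₀ − 1| < αε_{k+a}²`, `M^a` the `a`-fold average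
of record — ONE factor `2` for EVERY `a`, given `4C_Lα ≤ L²(L²−1)` and `32L²α ≤ δ_N∕2` («α₀′ sufficiently small»).
[cite: Balaban1987RG1, p.263 L9-16; Balaban1985Averaging, Prop. 1 (51) and Prop. 2 (53)-(54) p.26; King1986, (3.41) p.660] -/
theorem plaqSmall_two_mul_avIter (F : T4Family) (θ : Stage12Params F N) (k a : ℕ) (U₀ : GaugeField (F.P (k + a)) 0 (Node00.SU N))
    (h₀ : PlaqSmall (α F * F.eps (k + a) ^ 2) U₀) :
    PlaqSmall (2 * (α F * F.eps k ^ 2))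
      (avIter (Bk := fun k => GaugeField (F.P k) 0 (Node00.SU N)) (fun k => transportRaw F k (avOfRecord F N (k + 1) 0)) k a U₀) := by
  have h := (mem_image_ofBackgroundC_iff _ _).1
    (horig_plaqSmall_plaqEnvelope α hα hsmall hguard F θ k a U₀ h₀ 0 (cubeDom (F.P k) θ.τ9.M 0 fun _ => 0))
  exact fun p => (h p).trans_le (plaqEnvelope_le F (hα F).le k (hsmall F))

include hα in
/-- **THE GENERATED READING OF THE STRICTLY PLAQUETTE-SMALL FIELDS IS INHABITED AT EVERY SLOT** (A1 display): `U ≡ 1` is strictly small for a positive threshold.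
[cite: Balaban1987RG1, (0.18) p.255 and p.263 L19-21 (bookkeeping; non-vacuity)] -/
theorem admBg_spGen_plaqSmall_nonempty (F : T4Family) (θ : Stage12Params F N) (k : ℕ) :
    Nonempty (AdmBg F θ.τ9.M N (spGen F θ.τ9.M N (fun k (U : GaugeField (F.P k) 0 (Node00.SU N)) => PlaqSmall (α F * F.eps k ^ 2) U)
      (fun k => transportRaw F k (avOfRecord F N (k + 1) 0))) k) := by
  refine AdmBg.nonempty_spGen_of_strict (M := θ.τ9.M) (1 : GaugeField (F.P k) 0 (Node00.SU N)) fun p => ?_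
  have h1 : GaugeField.plaqHol (1 : GaugeField (F.P k) 0 (Node00.SU N)) p = 1 := by
    simp [GaugeField.plaqHol, show ∀ b : PBond (F.P k) 0, (1 : GaugeField (F.P k) 0 (Node00.SU N)) b = 1 from fun _ => rfl]
  rw [h1, GaugeGroup.dist1_one]
  exact mul_pos (hα F) (pow_pos (F.eps_pos k) 2)

variable (S : (F : T4Family) → (θ : Stage12Params F N) → (k : ℕ) → ClusterTower (F.P k) (MatA N) θ.τ9.M)
  (gauge : (F : T4Family) → (θ : Stage12Params F N) → (k : ℕ) → GaugeField (F.P k) 0 (Node00.SU N) → GaugeField (F.P k) 0 (Node00.SU N) → ℝ)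
  (hg : ∀ (F : T4Family) (θ : Stage12Params F N) (k : ℕ) (U U' : GaugeField (F.P k) 0 (Node00.SU N)), 0 ≤ gauge F θ k U U')
  (li : (F : T4Family) → Stage12Params F N → LetterInputs) (ℓ₃ : T4Family → NE3Letters₁₁)
  (ne2 : (F : T4Family) → Stage12Params F N → (ℕ → ℝ) → List (ULoop F) → ℕ → NE2Objects₁₁)
  (ne1 : (F : T4Family) → Stage12Params F N → (ℕ → ℝ) → List (ULoop F) → NE1pCarriers)

include hα hsmall hguard in
/-- ★ **N18 AT THE ENVELOPE TABLES ⇒ N18 AT node00-def-W1's GENERATED READING OF THE STRICTLY PLAQUETTE-SMALL FIELDS** [bookkeeping; module 16a §2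
`s_N18_readingGen₁₂_of_readingAdm` with §1's `hstrict` and dag-n18-e's `admTransport_plaqEnvelope`]: at `Pplus := PlaqSmall (α·ε_k²)`, `T₀ :=` the transport of record,
the generated reading's statement (`s_N18_readingGen₁₂_iff`: the η-rate inequality for all averages of record of strictly small fields) follows from the statement at
the envelope tables (module 13 `s_N18_readingAdmPlaqSmall₁₂_iff` at `a := e_{L,α}`).  Same towers, gauges, letters.
[cite: Balaban1987RG1, Thm 1 p.259, p.262 (iv), p.263 L5-16 and (1.18) p.263; Balaban1985Averaging, Prop. 1 (51) p.26] -/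
theorem s_N18_readingGenPlaqSmall₁₂_of_plaqEnvelope
    (hS : S_N18 (RRec₁₂ (readingOfRecord₁₂ (fun F θ => ReadingData.ofRecordAdm F θ.τ9.M N (S F θ)
      (fun (k j : ℕ) (_ : (domSys (F.P k) θ.τ9.M j).Dom) => ofBackgroundC (ιSU N) '' {V : GaugeField (F.P k) 0 (Node00.SU N) |
        PlaqSmall (α F * F.eps k ^ 2 * (1 + 4 * (143 * ((16 : ℝ) * (F.L : ℝ) ^ 2) ^ 2) * α F
          / ((F.L : ℝ) ^ 2 * ((F.L : ℝ) ^ 2 - 1)) * F.eps k ^ 2)) V})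
      (gauge F θ) (hg F θ) (fun k => transportRaw F k (avOfRecord F N (k + 1) 0)) (admTransport_plaqEnvelope α hα hsmall hguard F θ) (li F θ))
      ℓ₃ ne2 ne1))) :
    S_N18 (RRec₁₂ (readingOfRecord₁₂ (fun F θ => ReadingData.ofRecordGen F θ.τ9.M N
      (fun k (U : GaugeField (F.P k) 0 (Node00.SU N)) => PlaqSmall (α F * F.eps k ^ 2) U) (fun k => transportRaw F k (avOfRecord F N (k + 1) 0))
      (S F θ) (gauge F θ) (hg F θ) (li F θ)) ℓ₃ ne2 ne1)) :=
  s_N18_readingGen₁₂_of_readingAdm S (fun F _ k U => PlaqSmall (α F * F.eps k ^ 2) U) _ gauge hg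
    (fun F _ k => transportRaw F k (avOfRecord F N (k + 1) 0)) (fun F θ => admTransport_plaqEnvelope α hα hsmall hguard F θ) li ℓ₃ ne2 ne1
    (fun F θ k U hU j Y => plaqSmall_mem_plaqEnvelopeTable α hα F θ k U hU j Y) hS

end Envelope

/-! ## §2 At the canonical constant `α_L(N, F)`: no side condition -/

section Canonical

variable (S : (F : T4Family) → (θ : Stage12Params F N) → (k : ℕ) → ClusterTower (F.P k) (MatA N) θ.τ9.M)
  (gauge : (F : T4Family) → (θ : Stage12Params F N) → (k : ℕ) → GaugeField (F.P k) 0 (Node00.SU N) → GaugeField (F.P k) 0 (Node00.SU N) → ℝ)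
  (hg : ∀ (F : T4Family) (θ : Stage12Params F N) (k : ℕ) (U U' : GaugeField (F.P k) 0 (Node00.SU N)), 0 ≤ gauge F θ k U U')
  (li : (F : T4Family) → Stage12Params F N → LetterInputs) (ℓ₃ : T4Family → NE3Letters₁₁)
  (ne2 : (F : T4Family) → Stage12Params F N → (ℕ → ℝ) → List (ULoop F) → ℕ → NE2Objects₁₁)
  (ne1 : (F : T4Family) → Stage12Params F N → (ℕ → ℝ) → List (ULoop F) → NE1pCarriers)

/-- ★ **N18's STATEMENT OF RECORD AT THE CANONICAL ε-SMALL FIELDS, IN CLOSED FORM — TABLE FAMILY, THRESHOLDS AND TRANSPORT CLAUSE PINNED BY NAME** [bookkeeping;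
module 13 §5 `s_N18_readingAdmPlaqSmall₁₂_iff` at `a := e_{L,α_L(N,F)}(ε_k²)`, `hT :=` dag-n18-e's `admTransport_plaqEnvelope_alphaL`]: at the admissible reading of record
on the canonical envelope tables with the transport of record, `S_N18 (RRec₁₂ 𝔯)` ⇔ for every family `F`, datum key `h` (`θ := h.params`), run length `k`, member
`b ∈ ]0, θ.γ]`, history `g ∈ ]0, θ.γ]^ℕ`, every gauge field `U` of the `(k+1)`-th torus with `|∂U − 1| < e_{L,α_L}(ε_{k+1}²)` and every run-A domain `(j, X)`:
`|Re E^{(j)}_{S_k}(X; g; (ι(M U), 0)) − Re E^{(j+1)}_{S_{k+1}}(πX; b∷g; (ιU, 0))| ≤ C₅ · θ₅ ^ j · e^{−κ·d_j(X)}`, `M` the transport of record.  Residual objects: the towers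
`S`, the gauges, the letter inputs.  The tables are inhabited (`admBg_plaqEnvelope_alphaL_nonempty`).  NOT PRINTED; NOT proved.
[cite: Balaban1987RG1, (0.4) p.253, (0.18) p.255, (0.24)–(0.25) p.257, Thm 1 p.259, (1.11) p.262 and (1.18) p.263; Balaban1988RG2Cluster, (2.13) p.14;
Balaban1985Averaging, Prop. 1 (51) p.26] -/
theorem s_N18_readingAdmPlaqEnvelope₁₂_iff :
    S_N18 (RRec₁₂ (readingOfRecord₁₂ (fun F θ => ReadingData.ofRecordAdm F θ.τ9.M N (S F θ)
      (fun (k j : ℕ) (_ : (domSys (F.P k) θ.τ9.M j).Dom) => ofBackgroundC (ιSU N) '' {V : GaugeField (F.P k) 0 (Node00.SU N) |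
        PlaqSmall (min ((F.L : ℝ) ^ 2 * ((F.L : ℝ) ^ 2 - 1) / (4 * (143 * ((16 : ℝ) * (F.L : ℝ) ^ 2) ^ 2)))
            (deltaSU (Fin N) / 2 / (32 * (F.L : ℝ) ^ 2)) * F.eps k ^ 2
          * (1 + 4 * (143 * ((16 : ℝ) * (F.L : ℝ) ^ 2) ^ 2)
            * min ((F.L : ℝ) ^ 2 * ((F.L : ℝ) ^ 2 - 1) / (4 * (143 * ((16 : ℝ) * (F.L : ℝ) ^ 2) ^ 2)))
              (deltaSU (Fin N) / 2 / (32 * (F.L : ℝ) ^ 2))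
            / ((F.L : ℝ) ^ 2 * ((F.L : ℝ) ^ 2 - 1)) * F.eps k ^ 2)) V})
      (gauge F θ) (hg F θ) (fun k => transportRaw F k (avOfRecord F N (k + 1) 0)) (admTransport_plaqEnvelope_alphaL F θ) (li F θ)) ℓ₃ ne2 ne1)) ↔
      ∀ (F : T4Family) (D : Datum F N) (h : IsDatumOfRecord₁₂C F N D) (k : ℕ) (b : ℝ), 0 < b → b ≤ h.params.γ →
        ∀ g ∈ Window h.params.γ, ∀ (U : GaugeField (F.P (k + 1)) 0 (Node00.SU N)),
          PlaqSmall (min ((F.L : ℝ) ^ 2 * ((F.L : ℝ) ^ 2 - 1) / (4 * (143 * ((16 : ℝ) * (F.L : ℝ) ^ 2) ^ 2)))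
              (deltaSU (Fin N) / 2 / (32 * (F.L : ℝ) ^ 2)) * F.eps (k + 1) ^ 2
            * (1 + 4 * (143 * ((16 : ℝ) * (F.L : ℝ) ^ 2) ^ 2)
              * min ((F.L : ℝ) ^ 2 * ((F.L : ℝ) ^ 2 - 1) / (4 * (143 * ((16 : ℝ) * (F.L : ℝ) ^ 2) ^ 2)))
                (deltaSU (Fin N) / 2 / (32 * (F.L : ℝ) ^ 2))
              / ((F.L : ℝ) ^ 2 * ((F.L : ℝ) ^ 2 - 1)) * F.eps (k + 1) ^ 2)) U →
          ∀ X : Node00.W1.Dom (F.P k) h.params.τ9.M,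
          |(functionalC (S F h.params k) g (ofBackgroundC (ιSU N) (transportRaw F k (avOfRecord F N (k + 1) 0) U)) X).re -
              (functionalC (S F h.params (k + 1)) (prependCoupling b g) (ofBackgroundC (ιSU N) U) (pairOfRecord F h.params.τ9.M k X)).re| ≤
            (li F h.params).C₅ * (li F h.params).θ₅ ^ X.1 * Real.exp (-((li F h.params).κ * (domSys (F.P k) h.params.τ9.M X.1).dj X.2)) :=
  s_N18_readingAdmPlaqSmall₁₂_iff S _ (fun F θ => admTransport_plaqEnvelope_alphaL F θ) gauge hg li ℓ₃ ne2 ne1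

/-- **MODULE 10's ALL-FIELDS STATEMENT OF RECORD IMPLIES THE STATEMENT AT THE CANONICAL ε-SMALL FIELDS** [bookkeeping; module 13 §5
`s_N18_readingAdmPlaqSmall₁₂_of_ofRecord` with the transport clause supplied by dag-n18-e's `admTransport_plaqEnvelope_alphaL` — NO side condition].
[cite: Balaban1987RG1, (0.4) p.253, (0.18) p.255, Thm 1 p.259 and (1.18) p.263; Balaban1985Averaging, Prop. 1 (51) p.26] -/
theorem s_N18_readingAdmPlaqEnvelope₁₂_of_ofRecord
    (hS : S_N18 (RRec₁₂ (readingOfRecord₁₂ (fun F θ => ReadingData.ofRecord F θ.τ9.M N (S F θ) (gauge F θ) (hg F θ)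
      (fun k => transportRaw F k (avOfRecord F N (k + 1) 0)) (li F θ)) ℓ₃ ne2 ne1))) :
    S_N18 (RRec₁₂ (readingOfRecord₁₂ (fun F θ => ReadingData.ofRecordAdm F θ.τ9.M N (S F θ)
      (fun (k j : ℕ) (_ : (domSys (F.P k) θ.τ9.M j).Dom) => ofBackgroundC (ιSU N) '' {V : GaugeField (F.P k) 0 (Node00.SU N) |
        PlaqSmall (min ((F.L : ℝ) ^ 2 * ((F.L : ℝ) ^ 2 - 1) / (4 * (143 * ((16 : ℝ) * (F.L : ℝ) ^ 2) ^ 2)))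
            (deltaSU (Fin N) / 2 / (32 * (F.L : ℝ) ^ 2)) * F.eps k ^ 2
          * (1 + 4 * (143 * ((16 : ℝ) * (F.L : ℝ) ^ 2) ^ 2)
            * min ((F.L : ℝ) ^ 2 * ((F.L : ℝ) ^ 2 - 1) / (4 * (143 * ((16 : ℝ) * (F.L : ℝ) ^ 2) ^ 2)))
              (deltaSU (Fin N) / 2 / (32 * (F.L : ℝ) ^ 2))
            / ((F.L : ℝ) ^ 2 * ((F.L : ℝ) ^ 2 - 1)) * F.eps k ^ 2)) V})
      (gauge F θ) (hg F θ) (fun k => transportRaw F k (avOfRecord F N (k + 1) 0)) (admTransport_plaqEnvelope_alphaL F θ) (li F θ)) ℓ₃ ne2 ne1)) :=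
  s_N18_readingAdmPlaqSmall₁₂_of_ofRecord S _ (fun F θ => admTransport_plaqEnvelope_alphaL F θ) gauge hg li ℓ₃ ne2 ne1 hS

/-- **THE GENERATED TABLES OF THE STRICTLY `α_L ε_k²`-SMALL FIELDS LIE INSIDE THE CANONICAL ENVELOPE TABLES** — §1 at `α := α_L`, NO side condition (dag-n18-e's
`alphaL_pos` ∕ `alphaL_small` ∕ `alphaL_guard`). [cite: Balaban1987RG1, p.262 (iv), (1.11) p.262 and p.263 L5-16] -/
theorem spGen_plaqSmall_subset_plaqEnvelope_alphaL (F : T4Family) (θ : Stage12Params F N) (k j : ℕ) (Y : (domSys (F.P k) θ.τ9.M j).Dom) :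
    spGen F θ.τ9.M N (fun k (U : GaugeField (F.P k) 0 (Node00.SU N)) =>
        PlaqSmall (min ((F.L : ℝ) ^ 2 * ((F.L : ℝ) ^ 2 - 1) / (4 * (143 * ((16 : ℝ) * (F.L : ℝ) ^ 2) ^ 2)))
          (deltaSU (Fin N) / 2 / (32 * (F.L : ℝ) ^ 2)) * F.eps k ^ 2) U)
        (fun k => transportRaw F k (avOfRecord F N (k + 1) 0)) k j Y ⊆
      (fun (k j : ℕ) (_ : (domSys (F.P k) θ.τ9.M j).Dom) => ofBackgroundC (ιSU N) '' {V : GaugeField (F.P k) 0 (Node00.SU N) |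
        PlaqSmall (min ((F.L : ℝ) ^ 2 * ((F.L : ℝ) ^ 2 - 1) / (4 * (143 * ((16 : ℝ) * (F.L : ℝ) ^ 2) ^ 2)))
            (deltaSU (Fin N) / 2 / (32 * (F.L : ℝ) ^ 2)) * F.eps k ^ 2
          * (1 + 4 * (143 * ((16 : ℝ) * (F.L : ℝ) ^ 2) ^ 2)
            * min ((F.L : ℝ) ^ 2 * ((F.L : ℝ) ^ 2 - 1) / (4 * (143 * ((16 : ℝ) * (F.L : ℝ) ^ 2) ^ 2)))
              (deltaSU (Fin N) / 2 / (32 * (F.L : ℝ) ^ 2))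
            / ((F.L : ℝ) ^ 2 * ((F.L : ℝ) ^ 2 - 1)) * F.eps k ^ 2)) V}) k j Y :=
  spGen_plaqSmall_subset_plaqEnvelope
    (fun F => min ((F.L : ℝ) ^ 2 * ((F.L : ℝ) ^ 2 - 1) / (4 * (143 * ((16 : ℝ) * (F.L : ℝ) ^ 2) ^ 2))) (deltaSU (Fin N) / 2 / (32 * (F.L : ℝ) ^ 2)))
    alphaL_pos alphaL_small alphaL_guard F θ k j Y

/-- ★ **N18 AT THE CANONICAL ENVELOPE TABLES ⇒ N18 AT node00-def-W1's GENERATED READING OF THE STRICTLY `α_L ε_k²`-SMALL FIELDS — NO side condition** (§1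
`s_N18_readingGenPlaqSmall₁₂_of_plaqEnvelope` at `α := α_L`): the two ε-small readings of N18's statement of record now typed, ORDERED.
[cite: Balaban1987RG1, Thm 1 p.259, p.262 (iv), p.263 L5-16 and (1.18) p.263; Balaban1985Averaging, Prop. 1 (51) p.26] -/
theorem s_N18_readingGenPlaqSmall₁₂_of_plaqEnvelope_alphaL
    (hS : S_N18 (RRec₁₂ (readingOfRecord₁₂ (fun F θ => ReadingData.ofRecordAdm F θ.τ9.M N (S F θ)
      (fun (k j : ℕ) (_ : (domSys (F.P k) θ.τ9.M j).Dom) => ofBackgroundC (ιSU N) '' {V : GaugeField (F.P k) 0 (Node00.SU N) |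
        PlaqSmall (min ((F.L : ℝ) ^ 2 * ((F.L : ℝ) ^ 2 - 1) / (4 * (143 * ((16 : ℝ) * (F.L : ℝ) ^ 2) ^ 2)))
            (deltaSU (Fin N) / 2 / (32 * (F.L : ℝ) ^ 2)) * F.eps k ^ 2
          * (1 + 4 * (143 * ((16 : ℝ) * (F.L : ℝ) ^ 2) ^ 2)
            * min ((F.L : ℝ) ^ 2 * ((F.L : ℝ) ^ 2 - 1) / (4 * (143 * ((16 : ℝ) * (F.L : ℝ) ^ 2) ^ 2)))
              (deltaSU (Fin N) / 2 / (32 * (F.L : ℝ) ^ 2))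
            / ((F.L : ℝ) ^ 2 * ((F.L : ℝ) ^ 2 - 1)) * F.eps k ^ 2)) V})
      (gauge F θ) (hg F θ) (fun k => transportRaw F k (avOfRecord F N (k + 1) 0)) (admTransport_plaqEnvelope_alphaL F θ) (li F θ)) ℓ₃ ne2 ne1))) :
    S_N18 (RRec₁₂ (readingOfRecord₁₂ (fun F θ => ReadingData.ofRecordGen F θ.τ9.M N
      (fun k (U : GaugeField (F.P k) 0 (Node00.SU N)) =>
        PlaqSmall (min ((F.L : ℝ) ^ 2 * ((F.L : ℝ) ^ 2 - 1) / (4 * (143 * ((16 : ℝ) * (F.L : ℝ) ^ 2) ^ 2)))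
          (deltaSU (Fin N) / 2 / (32 * (F.L : ℝ) ^ 2)) * F.eps k ^ 2) U)
      (fun k => transportRaw F k (avOfRecord F N (k + 1) 0)) (S F θ) (gauge F θ) (hg F θ) (li F θ)) ℓ₃ ne2 ne1)) :=
  s_N18_readingGenPlaqSmall₁₂_of_plaqEnvelope
    (fun F => min ((F.L : ℝ) ^ 2 * ((F.L : ℝ) ^ 2 - 1) / (4 * (143 * ((16 : ℝ) * (F.L : ℝ) ^ 2) ^ 2))) (deltaSU (Fin N) / 2 / (32 * (F.L : ℝ) ^ 2)))
    alphaL_pos alphaL_small alphaL_guard S gauge hg li ℓ₃ ne2 ne1 hS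

end Canonical

end YMDAG.N18.W1Reading

end
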